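import Literature.Probability.LatticeModels.LoomisWhitney
import HarnessLib

/-!
# Boundary pairs of line-convex sets in `ℤ^{n+1}`: the equality `#∂A = 2 Σᵢ |πᵢ A|`

HONEST FRAMING. Part of the venture `Summits/Ventures/Crystal3D` (cell `crystal3d-full`); pure
`ℤ^{n+1}` combinatorics complementing `Literature/Probability/LatticeModels/LoomisWhitney.lean`,
which proves
`2 Σᵢ |πᵢ A| ≤ #(boundaryPairs A)` (`two_mul_sum_card_dropCoord_le_card_boundaryPairs`: every
coordinate line meeting `A` carries at least two boundary pairs).  Here: if every coordinate line
meets `A` in an INTERVAL (a «line-convex» set: `x, y ∈ A` on one line ⇒ the lattice points between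
them are in `A`), then each such line carries EXACTLY two boundary pairs, one in each sense, so

* `card_filter_boundaryPairs_eq_card_dropCoord` — `#{boundary pairs of direction (i, ±)} = |πᵢ A|`
  for a set line-convex in direction `i`;
* `card_boundaryPairs_eq_two_mul_sum_card_dropCoord` — `#(boundaryPairs A) = 2 Σᵢ |πᵢ A|` for a
  set line-convex in every direction (e.g. the lattice points of a convex body).

This is the counting device behind «surface energy = sum of shadows» for lattice polytopes (for
truncated octahedra of the fcc packing, whose contact deficiency is half the boundary pairs of two
chart images, `StickySpheres/FccDeficiencyIdentity.lean`).  Line-convexity in direction `i` is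
stated as an explicit hypothesis (no new definition): `x, y ∈ A` on one `eᵢ`-line and `z` between
them on that line ⇒ `z ∈ A`.

WHAT THIS IS NOT: nothing about packings; no cluster is constructed here.
-/

noncomputable section

open Finset

namespace Summit.Ventures.Crystal3D

open Literature.Probability.LatticeModels

variable {n : ℕ}

/-- Two points of `ℤ^{n+1}` with the same projection forgetting `i` and the same `i`-th coordinate
are equal. -/
theorem eq_of_removeNth_eq_of_apply_eq {i : Fin (n + 1)} {x y : Site (n + 1)}
    (h : Fin.removeNth i x = Fin.removeNth i y) (hi : x i = y i) : x = y := by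
  rw [← Fin.insertNth_self_removeNth i x, ← Fin.insertNth_self_removeNth i y, h, hi]

/-- Moving along `± eᵢ` does not change the projection forgetting `i`. -/
theorem removeNth_add_unitStep (i : Fin (n + 1)) (b : Bool) (x : Site (n + 1)) :
    Fin.removeNth i (x + unitStep i b) = Fin.removeNth i x := by
  funext l
  simp only [Fin.removeNth, Pi.add_apply, unitStep_apply, if_neg (Fin.succAbove_ne i l), add_zero]

/-- **One boundary pair per line and sense.** For a set line-convex in direction `i`, the boundary
pairs of direction `(i, b)` are in bijection with the lines of direction `eᵢ` meeting the set:
`#{t ∈ boundaryPairs A | t.2 = (i, b)} = |πᵢ A|`. -/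
theorem card_filter_boundaryPairs_eq_card_dropCoord (i : Fin (n + 1)) (b : Bool)
    (A : Finset (Site (n + 1)))
    (hA : ∀ x ∈ A, ∀ y ∈ A, Fin.removeNth i x = Fin.removeNth i y →
      ∀ z : Site (n + 1), Fin.removeNth i z = Fin.removeNth i x → x i ≤ z i → z i ≤ y i → z ∈ A) :
    #{t ∈ boundaryPairs A | t.2 = (i, b)} = #(dropCoord i A) := by
  classical
  refine le_antisymm ?_ (card_dropCoord_le_card_filter_boundaryPairs i b A)
  -- the projection is injective on the boundary pairs of one sense
  refine card_le_card_of_injOn (fun t => Fin.removeNth i t.1) (fun t ht => ?_) ?_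
  · have ht' := (mem_filter.1 (mem_coe.1 ht)).1
    rw [mem_boundaryPairs] at ht'
    exact mem_coe.2 (mem_dropCoord_iff.2 ⟨t.1, ht'.1, rfl⟩)
  · intro t ht t' ht' heq
    obtain ⟨htb, ht2⟩ := mem_filter.1 (mem_coe.1 ht)
    obtain ⟨htb', ht2'⟩ := mem_filter.1 (mem_coe.1 ht')
    rw [mem_boundaryPairs] at htb htb'
    have hdir : t.2 = t'.2 := ht2.trans ht2'.symm
    -- the two base points lie on one line; the one «behind» would have its successor in `A`
    suffices hx : t.1 = t'.1 from Prod.ext hx hdir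
    have key : ∀ (u v : Site (n + 1)), u ∈ A → v ∈ A → u + unitStep i b ∉ A →
        Fin.removeNth i u = Fin.removeNth i v → (if b then u i < v i else v i < u i) → False := by
      intro u v hu hv hout huv hlt
      apply hout
      cases b with
      | true =>
        simp only [if_true] at hlt
        refine hA u hu v hv huv (u + unitStep i true) (removeNth_add_unitStep i true u) ?_ ?_
        · simp [unitStep_apply]
        · have : (u + unitStep i true) i = u i + 1 := by simp [unitStep_apply]
          rw [this]; omega
      | false =>
        simp only [Bool.false_eq_true, if_false] at hlt
        refine hA v hv u hu huv.symm (u + unitStep i false) ?_ ?_ ?_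
        · rw [removeNth_add_unitStep, huv]
        · have : (u + unitStep i false) i = u i - 1 := by simp [unitStep_apply]; ring
          rw [this]; omega
        · have : (u + unitStep i false) i = u i - 1 := by simp [unitStep_apply]; ring
          rw [this]; omega
    have ht2i : t.2 = (i, b) := ht2
    have ht2i' : t'.2 = (i, b) := ht2'
    have hout : t.1 + unitStep i b ∉ A := by
      have := htb.2; rw [ht2i] at this; exact this
    have hout' : t'.1 + unitStep i b ∉ A := by
      have := htb'.2; rw [ht2i'] at this; exact this
    rcases lt_trichotomy (t.1 i) (t'.1 i) with hlt | heqi | hgt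
    · exfalso
      cases b with
      | true => exact key t.1 t'.1 htb.1 htb'.1 hout heq (by simpa using hlt)
      | false => exact key t'.1 t.1 htb'.1 htb.1 hout' heq.symm (by simpa using hlt)
    · exact eq_of_removeNth_eq_of_apply_eq heq heqi
    · exfalso
      cases b with
      | true => exact key t'.1 t.1 htb'.1 htb.1 hout' heq.symm (by simpa using hgt)
      | false => exact key t.1 t'.1 htb.1 htb'.1 hout heq (by simpa using hgt)

/-- **`#∂A = 2 Σᵢ |πᵢ A|` for line-convex sets.** If `A ⊆ ℤ^{n+1}` is line-convex in every
coordinate direction, its boundary pairs number exactly twice the total size of its coordinate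
projections (equality in `two_mul_sum_card_dropCoord_le_card_boundaryPairs`). -/
theorem card_boundaryPairs_eq_two_mul_sum_card_dropCoord (A : Finset (Site (n + 1)))
    (hA : ∀ i : Fin (n + 1), ∀ x ∈ A, ∀ y ∈ A, Fin.removeNth i x = Fin.removeNth i y →
      ∀ z : Site (n + 1), Fin.removeNth i z = Fin.removeNth i x → x i ≤ z i → z i ≤ y i → z ∈ A) :
    #(boundaryPairs A) = 2 * ∑ i : Fin (n + 1), #(dropCoord i A) := by
  classical
  have hdecomp : #(boundaryPairs A) =
      ∑ c : Fin (n + 1) × Bool, #{t ∈ boundaryPairs A | t.2 = c} :=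
    card_eq_sum_card_fiberwise fun t _ => mem_coe.2 (mem_univ t.2)
  rw [hdecomp, Fintype.sum_prod_type, mul_sum]
  refine sum_congr rfl fun i _ => ?_
  rw [Fintype.sum_bool, card_filter_boundaryPairs_eq_card_dropCoord i true A (hA i),
    card_filter_boundaryPairs_eq_card_dropCoord i false A (hA i), two_mul]

end Summit.Ventures.Crystal3D

end
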